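import Mathlib
import Summits.KontsevichZagierPeriods.Zeta5Search.SecondOrderDigit
import Summits.KontsevichZagierPeriods.Zeta5Search.CollinearityShift
import HarnessLib

/-!
# ζ(5) search — the second-order class invariants are unchanged on unhit classes under `b ↦ b + e_j`

Cell `pub-zeta5` (HONEST FRAMING: systematic search; no irrationality claim unless certified), typer seat generation 11.
REPORT-gen2-g10 §2.3 ("unhit classes keep their type, hence `ŵ, v̂, τ, P`"): on a residue class whose class exponent does not move
under the shift (an UNHIT class, `CollinearityShift.unhit`), the second-order data of `Zeta5Search/SecondOrderDigit.lean` are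
unchanged: `ŵ`, `ŵ₂`, `v̂₂`, the top level, `τ_W`, `τ_V` (`wHat_shift_of_classExp_eq`, `wHat2_shift_of_classExp_eq`,
`vHat2_shift_of_classExp_eq`, `topLevel_shift`, `tauW_shift_of_classExp_eq`, `tauV_shift_of_classExp_eq`), after typer g10's
`classRho_shift_of_classExp_eq` / `vHat_shift_of_classExp_eq`.  Tools for the second-order collinearity criterion; nothing about irrationality.
-/

noncomputable section

open Finset

namespace Summit.KontsevichZagierPeriods.Zeta5Search.SecondOrder

open Summit.KontsevichZagierPeriods.Zeta5Search.DualSeries (InBox)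
open Summit.KontsevichZagierPeriods.Zeta5Search.CasoratianValuation (InPolytope shift)
open Summit.KontsevichZagierPeriods.Zeta5Search.ClusterValuation
open Summit.KontsevichZagierPeriods.Zeta5Search.BigPrime (shift_zero)

variable {p : ℕ}

section ShiftInvariance

variable (b : ℕ → ℤ) {j : ℕ} (hb : InBox b) (hj1 : 1 ≤ j)
include hb hj1

/-- On an unhit class `ŵ_x` is unchanged. -/
theorem wHat_shift_of_classExp_eq {x : ℕ} (hE : classExp (shift b j) p x = classExp b p x) :
    wHat (shift b j) p x = wHat b p x := by
  have hnet := netExp_shift_eq_of_classExp_eq b hb hj1 hE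
  unfold wHat
  rw [classPoles_shift_of_classExp_eq b hb hj1 hE]
  refine sum_congr rfl fun q hq => ?_
  have hqC : q ∈ classSet b p x := (mem_filter.1 hq).1
  rw [hnet q hqC, classRho_shift_of_classExp_eq b hb hj1 hE hqC]

/-- On an unhit class `ŵ₂_x` is unchanged. -/
theorem wHat2_shift_of_classExp_eq {x : ℕ} (hE : classExp (shift b j) p x = classExp b p x) :
    wHat2 (shift b j) p x = wHat2 b p x := by
  have hnet := netExp_shift_eq_of_classExp_eq b hb hj1 hE
  unfold wHat2
  rw [classPoles_shift_of_classExp_eq b hb hj1 hE]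
  refine sum_congr rfl fun q hq => ?_
  have hqC : q ∈ classSet b p x := (mem_filter.1 hq).1
  rw [hnet q hqC, classRho_shift_of_classExp_eq b hb hj1 hE hqC, classRho_shift_of_classExp_eq b hb hj1 hE hqC]

/-- On an unhit class `v̂₂_x` is unchanged. -/
theorem vHat2_shift_of_classExp_eq {x : ℕ} (hE : classExp (shift b j) p x = classExp b p x) :
    vHat2 (shift b j) p x = vHat2 b p x := by
  have hnet := netExp_shift_eq_of_classExp_eq b hb hj1 hE
  unfold vHat2
  rw [classPoles_shift_of_classExp_eq b hb hj1 hE]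
  refine sum_congr rfl fun q hq => ?_
  have hqC : q ∈ classSet b p x := (mem_filter.1 hq).1
  rw [hnet q hqC]
  exact sum_congr rfl fun σ _ => by
    rw [classRho_shift_of_classExp_eq b hb hj1 hE hqC, classRho_shift_of_classExp_eq b hb hj1 hE hqC]

omit hb in
/-- The top level does not depend on the lower parameters. -/
theorem topLevel_shift (x : ℕ) : topLevel (shift b j) p x = topLevel b p x := by
  unfold topLevel; rw [shift_zero b hj1]

/-- On an unhit class `τ_W` is unchanged. -/
theorem tauW_shift_of_classExp_eq {x : ℕ} (hE : classExp (shift b j) p x = classExp b p x) :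
    tauW (shift b j) p x = tauW b p x := by
  unfold tauW
  rw [wHat2_shift_of_classExp_eq b hb hj1 hE, wHat_shift_of_classExp_eq b hb hj1 hE, topLevel_shift b hj1]

/-- On an unhit class `τ_V` is unchanged. -/
theorem tauV_shift_of_classExp_eq {x : ℕ} (hE : classExp (shift b j) p x = classExp b p x) :
    tauV (shift b j) p x = tauV b p x := by
  unfold tauV
  rw [vHat2_shift_of_classExp_eq b hb hj1 hE, vHat_shift_of_classExp_eq b hb hj1 hE, topLevel_shift b hj1]

/-- On an unhit conjugate pair the orbit `W`-component is unchanged. -/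
theorem orbitW_shift_of_classExp_eq {x : ℕ} (hE : classExp (shift b j) p x = classExp b p x)
    (hEc : classExp (shift b j) p (conjClass b p x) = classExp b p (conjClass b p x)) :
    orbitW (shift b j) p x = orbitW b p x := by
  unfold orbitW
  rw [shift_zero b hj1, wHat_shift_of_classExp_eq b hb hj1 hE]
  have hc : conjClass b p x = ((b 0).toNat - x) % p := rfl
  rw [← hc, wHat_shift_of_classExp_eq b hb hj1 hEc]
  simp only [centreIn_shift b hj1]

/-- On an unhit conjugate pair the orbit `V`-component is unchanged. -/
theorem orbitV_shift_of_classExp_eq {x : ℕ} (hE : classExp (shift b j) p x = classExp b p x)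
    (hEc : classExp (shift b j) p (conjClass b p x) = classExp b p (conjClass b p x)) :
    orbitV (shift b j) p x = orbitV b p x := by
  unfold orbitV
  rw [shift_zero b hj1, vHat_shift_of_classExp_eq b hb hj1 hE]
  have hc : conjClass b p x = ((b 0).toNat - x) % p := rfl
  rw [← hc, vHat_shift_of_classExp_eq b hb hj1 hEc]
  simp only [centreIn_shift b hj1]

end ShiftInvariance

end Summit.KontsevichZagierPeriods.Zeta5Search.SecondOrder

end
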